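import Summits.Ventures.HodgeRepro2.T6A2WeilLange
import Summits.Ventures.HodgeRepro2.T6A2WeilLef
import Summits.Ventures.HodgeRepro2.T6A1Dict

/-!
# T6A2WeilHalg — the algebraic classes of the host transfer shadow go to the host's coniveau classes

Cell pub-hodge-repro2, Tier 6 (README §10), seat t6-p2 (A2 owner); the lead's ask STATUS l. 11045 (3): the
binder `halg : ∀ y ∈ D.Alg 2, (hostIdentW …).φ₄ (extC K y) ∈ (coniveau C.B.X (2 * 2) 2).baseChange ℂ` of
t6-p1's `splitWeilAlgebraic_of_periodN` / the lead's `splitWeilAlgebraic_of_clauses`, for the shadow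
`D := transferShadowWeil` of this seat (`D.Alg = (identB …).algOf`, `transferShadowWeil_Alg`).
* `evOf_ofDeg_cupAltW`: the identification `ev` sends the four-fold cup `a ∪ b ∪ c ∪ d` of the host to the
  wedge monomial `φ₁⁻¹a ∧ φ₁⁻¹b ∧ φ₁⁻¹c ∧ φ₁⁻¹d` of the model;
* **`lange4_extC_evOf_ofDeg`**: for t6-p1's degree-4 map `lange4 φ₁ (lange4C Bd D.B hL)` (= the `φ₄` of
  `H1Ident.ofLange` at this seat's Lange isomorphism) and a complex `φ₁` agreeing on the rational points with
  this seat's rational `OrderAction.φ₁` transported to the host (`hφ`, t6-p1's `mk_one_phiQ`), the composite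
  `H⁴(B, ℚ)_host → H⁴(B, ℚ)_model → H⁴(B, ℂ)_model → ℂ ⊗ H⁴(B(ℂ), ℚ)` is `c ↦ 1 ⊗ isoObj c` — checked on the
  spanning four-fold cups (`span_range_cupAltW`, `LinearMap.ext_on`);
* **`lange4_extC_mem_baseChange_coniveau`** (`halg` by name): an algebraic class `y ∈ (identB …).algOf 2` of
  the model is `ev (ofDeg 2 c)` with `c` a rational algebraic class of the host (`exists_of_mem_algOf`,
  `mem_algebraicClasses_iff`), and clause (b) of the lead's `Hyp.BettiHodge` (the binder `hb`, at `D.B`) puts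
  `isoObj c` into the host's `coniveau`, hence `1 ⊗ isoObj c` into its base change.
No display is consumed: the printed inputs enter as the binders `hL` (Lange) and `hb` (clause (b)). No
`sorry`; standard axioms. §8(d): uses an L-value-free non-vanishing device: NO.
-/

noncomputable section

namespace Summit.Ventures.HodgeRepro2.T6.WeilHalg

open HostAPI.Carriers.AlgebraicGeometry.Motives CategoryTheory Opposite
open Summit.Ventures.HodgeRepro2.T6 Summit.Ventures.HodgeRepro2.T6.A2Gysin
open scoped TensorProduct DirectSum
open WeilInst WeilLange Host A1Dict

variable {K : Type*} [Field K] [NumberField K] (Bd : BettiHodgeData ℂ) (D : SituationData ℂ)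
  (A : OrderAction Bd.W D.B K) (hL : Function.Bijective (langeMap Bd.W D.B))

/-- `ev` sends `ofDeg 2` of the four-fold cup product `(a ∪ b) ∪ (c ∪ d)` to the wedge monomial of the
`φ₁⁻¹`-images. -/
theorem evOf_ofDeg_cupAltW (v : Fin 4 → Bd.W.obj D.B.X 1) :
    evOf Bd.W D A hL (ofDeg Bd.W D.B 2 (cupAltW Bd.W D.B 4 v)) =
      ExteriorAlgebra.ιMulti ℚ 4 (fun i => A.φ₁.symm (v i)) := by
  rw [evOf_apply, evenToFull_ofDeg]
  change ExteriorAlgebra.map (A.φ₁.symm : Bd.W.obj D.B.X 1 →ₗ[ℚ] H1 K)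
    ((langeEquiv Bd.W D hL).symm (ofDegF Bd.W D.B 4
      (langeDegMap Bd.W D.B 4 (exteriorPower.ιMulti ℚ 4 v)))) = _
  rw [← langeMap_eq_ofDegF, ← langeEquiv_apply Bd.W D hL, AlgEquiv.symm_apply_apply,
    exteriorPower.ιMulti_apply_coe, ExteriorAlgebra.map_apply_ιMulti]
  rfl

/-- THE DEGREE-4 COMPATIBILITY of the two dictionaries: for a complex `φ₁ : H¹(B, ℂ)_model ≃ ℂ ⊗ H¹(B(ℂ), ℚ)`
agreeing on the rational points with the transport of this seat's rational `OrderAction.φ₁` (`hφ`),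
t6-p1's `lange4 φ₁ e` at this seat's Lange isomorphism `e = lange4C` sends `extC (ev (ofDeg 2 c))` to
`1 ⊗ isoObj c`, for every `c ∈ H⁴(B, ℚ)` of the host. -/
theorem lange4_extC_evOf_ofDeg (φ₁ : H1C K ≃ₗ[ℂ] HC D.B.X 1)
    (hφ : ∀ w : H1 K, φ₁ (h1ToC K w) = (1 : ℂ) ⊗ₜ[ℚ] Bd.isoObj D.B.X 1 (A.φ₁ w))
    (c : Bd.W.obj D.B.X (2 * 2)) :
    lange4 φ₁ (lange4C Bd D.B hL) (extC K (evOf Bd.W D A hL (ofDeg Bd.W D.B 2 c))) =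
      (1 : ℂ) ⊗ₜ[ℚ] Bd.isoObj D.B.X (2 * 2) c := by
  -- both sides are `ℚ`-linear in `c`; compare them on the spanning four-fold cup products
  let L : Bd.W.obj D.B.X (2 * 2) →ₗ[ℚ] HC D.B.X (2 * 2) :=
    (lange4 φ₁ (lange4C Bd D.B hL)).restrictScalars ℚ ∘ₗ (extC K).toLinearMap ∘ₗ
      (evOf Bd.W D A hL).toLinearMap ∘ₗ ofDeg Bd.W D.B 2
  let R : Bd.W.obj D.B.X (2 * 2) →ₗ[ℚ] HC D.B.X (2 * 2) :=
    TensorProduct.mk ℚ ℂ (HQ D.B.X (2 * 2)) 1 ∘ₗ (Bd.isoObj D.B.X (2 * 2)).toLinearMap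
  have hLR : L = R := by
    refine LinearMap.ext_on (span_range_cupAltW Bd.W D.B hL 4) ?_
    rintro _ ⟨v, rfl⟩
    show lange4 φ₁ (lange4C Bd D.B hL) (extC K (evOf Bd.W D A hL (ofDeg Bd.W D.B 2 (cupAltW Bd.W D.B 4 v)))) =
      (1 : ℂ) ⊗ₜ[ℚ] Bd.isoObj D.B.X (2 * 2) (cupAltW Bd.W D.B 4 v)
    rw [evOf_ofDeg_cupAltW, A1ComplexWeil.extC_ιMulti_eq K, lange4_ιMulti, lange4C_ιMulti]
    simp only [Function.comp_apply, hφ, LinearEquiv.apply_symm_apply]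
    show cupMC4 D.B (fun j => (1 : ℂ) ⊗ₜ[ℚ] Bd.isoObj D.B.X 1 (v j)) = _
    rw [cupMC4_tmul, cupAltQ_apply]
    congr 3
    funext j
    exact LinearEquiv.symm_apply_apply _ _
  exact DFunLike.congr_fun hLR c

/-- **THE `halg` BINDER OF THE HOST COMPOSITE, FOR THIS SEAT'S SHADOW** (the lead's l. 11045 (3)): under
clause (b) of `Hyp.BettiHodge` at `B` (`hb`: the algebraic classes of `Bd.W` are the host's `coniveau` classes
pulled back along `isoObj`) and the degree-1 compatibility `hφ`, every algebraic class `y ∈ (identB …).algOf 2`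
of the model (= `(transferShadowWeil …).Alg 2`, `transferShadowWeil_Alg`) is sent by t6-p1's degree-4 map at
this seat's Lange isomorphism into the base change of the host's `coniveau B 4 2`. -/
theorem lange4_extC_mem_baseChange_coniveau (hgen : D.HasGens) (hten : D.ProductsSmooth)
    (φ₁ : H1C K ≃ₗ[ℂ] HC D.B.X 1)
    (hφ : ∀ w : H1 K, φ₁ (h1ToC K w) = (1 : ℂ) ⊗ₜ[ℚ] Bd.isoObj D.B.X 1 (A.φ₁ w))
    (hb : ∀ p : ℕ, Bd.W.algebraicClasses D.B.X p =
      (coniveau D.B.X (2 * p) p).comap (Bd.isoObj D.B.X (2 * p)).toLinearMap) :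
    ∀ y ∈ (identB Bd.W D hgen hten A hL).algOf 2,
      lange4 φ₁ (lange4C Bd D.B hL) (extC K y) ∈ (coniveau D.B.X (2 * 2) 2).baseChange ℂ := by
  intro y hy
  obtain ⟨c, hc, rfl⟩ := exists_of_mem_algOf Bd.W D hgen hten A hL hy
  rw [lange4_extC_evOf_ofDeg Bd D A hL φ₁ hφ c]
  apply Submodule.tmul_mem_baseChange_of_mem
  have h1 : c ∈ Bd.W.algebraicClasses D.B.X 2 := (mem_algebraicClasses_iff Bd.W D.B 2 c).2 hc
  rw [hb 2] at h1
  exact Submodule.mem_comap.1 h1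

end Summit.Ventures.HodgeRepro2.T6.WeilHalg

end
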